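import Summits.ABC.IUTFork.Conditional.WRowBrobergMixedSeven
import HarnessLib

/-!
# R-W WINDOW-TABLE, W1 ROW 10 — `pilotDataOfK:broberg-Q7:11` (F_tpd = ℚ(√7), `l = 11`): the hull licence S_H INHABITED over the MIXED-FIBRE socket,
# modulo the local types BY NAME

PROOF-ONLY file (D-0012; 0 definitions, 0 `Prop` facts) of the abc-iut cell — D-0079 RESCUE sub-cell R-W «WINDOW Θ-SIDE INEQUALITY», W1 ROW
DECISIONS seat abc-iut-W-row-2 (gen 2); row 10 of HOME/plan/rescue/R-W/OPEN-10.md (sha16 1b0025ee7a8ba6d7, abc-iut-rw-num-lead): the Broberg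
datum over `ℚ(√7)` (`λ = (8−3Y)²(5−2Y)/(4−3Y)⁴`, `Y² = 7`; poles of `j(λ)`: two places over `3` with `h = 24` and `h = 2`, one over `47` with `h = 8`),
the ONLY rows of the table with MIXED bad fibres (the bad completions over `3` are not pairwise `ℚ_3`-isomorphic), hence not composable on the
single-type sockets of rows 1–8. The socket here is abc-iut-w5-d180's `Thm311.Real.licence_settingPrVolSharp_of_mixedOrders_of_realises`
(`Cor312LicenceWildInhabitedMixed`, p476904): per prime a type map, per type `(e, D, P, ρin, ρout)` with one-sided local witnesses, `ℚ_p`-isomorphisms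
INSIDE a type only, and per label a cell for every TYPE PROFILE of the tuple (one extra different charged per extra type).

WHAT IS PROVED (namespace `Summit.ABC.IUTFork.Conditional`, general `X : PilotData F` over ANY number field — the tree holds no `NFPoint` for
`(ℚ(√7), λ)` yet, so the datum's fibre shape is taken BY NAME): **`WRow.licence_of_brobergTypes_eleven`** — IF `l⋆ = 5`, the bad places of `X` lie
over `3` and `47`, those over `3` are of type A (`e = eA`, `P_q = 12·eA/11`) or B (`e = eB`, `P_q = eB/11`) according to a type map `c`, those over
`47` of one type (`e = eC`, `P_q = 4·eC/11`), with `110 ∣ eA`, `330 ∣ eB`, `165 ∣ eC`, and same-type bad completions are `ℚ_p`-isomorphic, THEN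
`Thm311ToCor312.Licence (settingPrVolSharp X …)` for every analytic `logv` and every pair of realising ideles; **`WRow.exists_qPinned_and_hull_of_brobergTypes_eleven`**
— branch C's «∃ ρ qK, QPinned ∧ PilotKummerCompatHull» there, any columns. DISCHARGED (no hypothesis): `D = e − 1`, `ρin = e/2` (over `3`) / `1`
(over `47`), `ρout = min` of two envelope members, and ALL type-profile cells — the shallow type B, when present in a tuple, is taken as the
Θ-slot `s` (Θ-side `≤ j²/11`, q-side `≥ 2(j+1)`); all-A and all-C tuples are the single-type cells of the `h = 24` / `h = 8` places, valid for EVERY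
`eA ∈ 110ℕ`, `eC ∈ 165ℕ` (affine and decreasing in `1/e`). READING (neutral; numbers, not adjectives): the R-W table's INHABITED verdict for
broberg-Q7:11 survives the mixed cell's extra-type charge at every label and profile; what remains hypothetical is exactly the datum's fibre
structure (which a future `NFPoint` for `(ℚ(√7), λ)` with its pole orders `24, 2, 8` and the Galois conjugacy per `F_mod`-place would supply) and the
local indices' divisibilities (`l`-torsion, `5`-torsion, `ζ_3`, the `3`-Kummer root at the `h = 2` place). HONEST SCOPE: OUR sharp containers and
Dupuy–Hilado's typed (Ind1)/(Ind2); STRONGER-THAN-PRINT hull reading; NON-EMPTINESS of such data, admissibility and Szpiro-badness NOT claimed;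
nothing about the printed GLOBAL inequality; typed ≠ proved; instantiated ≠ endorsed; no abc claim.
[cite: Mochizuki2012, IUTchI Def. 3.1 (b),(c) pp. 61–62; IUTchIII Cor. 3.12 Step (xi-d) p. 183, (xi-f) p. 184, Thm. 3.11 (i) (Ind1)(Ind2) p. 154; IUTchIV Prop. 1.1 p. 9, Prop. 1.2 (i)(ii) p. 10, Prop. 1.4 (i)(ii) p. 13, Cor. 2.2 (ii) proof (P5) p. 46]
[cite: DupuyHilado2025, §3.3, §3.4, §3.9, §4.9, §4.12] [cite: NeukirchANT1999, Ch. II (5.5)–(5.7)] [claim: Mochizuki2012, status: disputed] for every IUT sentence.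
-/

noncomputable section

open Set Function Metric NumberField IsDedekindDomain

namespace Summit.ABC.IUTFork.Conditional

open Thm311 Thm311.Real Cor312 Cor312.Setting Cor312Vol Cor312Prov Literature.IUT.LogThetaLattice Literature.IUT.LogVolume
  Literature.IUT.HodgeTheaters
open Literature.NumberTheory.NumberFields Literature.NumberTheory.GaloisRepresentations.Ultrametric

/-! ## The composition at `l = 11` -/

variable {F : Type} [Field F] [NumberField F] (X : PilotData F) {logv : PadicLogs F} (hlog : LogvAnalytic logv)
  (M : Type) [Field M] [NumberField M]
  (archPk : ∀ (j : (thetaIndex X).Label) (vQ : (thetaIndex X).VQ), Set ((logShellsDH X logv).Packet j vQ))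
  (archSub : ∀ (j : (thetaIndex X).Label) (v : (thetaIndex X).V),
    Set ((logShellsDH X logv).Packet j ((thetaIndex X).over v)))
  (Ψ : ℤ → ∀ v : (thetaIndex X).V, v ∈ (thetaIndex X).Vbad → Set ((logShellsDH X logv).StarPacket v))
  (act : ℤ → ∀ v : (thetaIndex X).V, v ∈ (thetaIndex X).Vbad →
    (logShellsDH X logv).StarPacket v → Module.End ℚ ((logShellsDH X logv).StarPacket v))
  (Mmod : ℤ → ∀ j : (thetaIndex X).LabelStar, Set ((logShellsDH X logv).GlobalPacket j.1))
  (region : ℤ → ∀ j : (thetaIndex X).LabelStar, FinDivisor M → ∀ vQ : (thetaIndex X).VQ,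
    Set ((logShellsDH X logv).Packet j.1 vQ))
  (n : ℤ) {HT : Type} {LogLink : HT → HT → Type} {IsFull : ∀ {s t : HT}, LogLink s t → Prop}
  (lat : LGPGaussianLogThetaLattice LogLink IsFull)
  {Frd : Type} {IsoF : Frd → Frd → Type} {Ob : Frd → Type} {realify : Frd → Frd} {Strip : Type}
  {IsoS : Strip → Strip → Type} {Mv : ∀ v : (thetaIndex X).V, v ∈ (thetaIndex X).Vbad → Type}
  [∀ v h, Monoid (Mv v h)]
  (sig : GlobalLGPFrobenioidSignature (thetaIndex X).lstar (thetaIndex X).V (· ∈ (thetaIndex X).Vbad)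
    Frd IsoF Ob realify Strip IsoS Mv)
  (split : SplittingMonoids Mv) {ObΔ : Type} {N : ∀ v : (thetaIndex X).V, v ∈ (thetaIndex X).Vbad → Type}
  [∀ v h, Monoid (N v h)] (qData : QPilotData ObΔ N)
  (tq : ∀ (pp : Nat.Primes) (x : (thetaIndex X).Fibre (.inr pp)), haveI : Fact (pp : ℕ).Prime := ⟨pp.2⟩; kOf X pp.1 x)
  (t : ∀ (pp : Nat.Primes) (_ : Fin X.lstar) (x : (thetaIndex X).Fibre (.inr pp)),
    haveI : Fact (pp : ℕ).Prime := ⟨pp.2⟩; kOf X pp.1 x)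
  (htq0 : ∀ pp x, tq pp x ≠ 0)
  (htq1 : ∀ (pp : Nat.Primes) (x : (thetaIndex X).Fibre (.inr pp)),
    haveI : Fact (pp : ℕ).Prime := ⟨pp.2⟩; placeOf X pp.1 x ∉ X.S → ‖tq pp x‖ = 1)
  (col : ℤ → Column (logShellsDH X logv))
  (ht0 : ∀ pp i x, t pp i x ≠ 0)
  (ht : ∀ (pp : Nat.Primes) (i : Fin X.lstar) (x : (thetaIndex X).Fibre (.inr pp)),
    haveI : Fact (pp : ℕ).Prime := ⟨pp.2⟩
    Real.log ‖t pp i x‖ = -(X.thetaPilot i (placeOf X pp.1 x)) * logNorm F (placeOf X pp.1 x) /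
      localDegree F (placeOf X pp.1 x))
  (htq : ∀ (pp : Nat.Primes) (x : (thetaIndex X).Fibre (.inr pp)),
    haveI : Fact (pp : ℕ).Prime := ⟨pp.2⟩
    Real.log ‖tq pp x‖ = -(X.qPilot (placeOf X pp.1 x)) * logNorm F (placeOf X pp.1 x) /
      localDegree F (placeOf X pp.1 x))

set_option maxHeartbeats 400000 in
include ht0 ht htq in
/-- **W1 ROW 10 (broberg-Q7 @ `l = 11`), INHABITED SIDE, over the MIXED-FIBRE socket — modulo the local types BY NAME.**
For ANY pilot data `X` over any number field with `l⋆ = 5`, any analytic `p`-adic logarithms, any pair of Θ- and q-ideles REALISING the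
pilot divisors, and a type map `c` on the fibres: IF the bad places of `X` lie over `3` and `47` only (`hbad`), those over `3` fall into two types
— type A (`c x = 0`): `e(K_x/ℚ_3) = eA` and `P_q(x) = 12·eA/11` (the `h = 24` place of the R-W table), type B (`c x = 1`): `e(K_x/ℚ_3) = eB`,
`P_q(x) = eB/11` (the `h = 2` place) — and those over `47` form one type (`c x = 0`, `e = eC`, `P_q(x) = 4·eC/11`, `h = 8`), with
`110 ∣ eA`, `330 ∣ eB`, `165 ∣ eC` (the table's lower local types `e_v·l`, `e_v ∈ 10ℕ / 30ℕ / 15ℕ`) and bad completions of the SAME type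
`ℚ_p`-isomorphic (`hiso`), THEN abc-iut-c312-1's `Thm311ToCor312.Licence` HOLDS at abc-iut-c312-7's `settingPrVolSharp X …`. Discharged
inside (no hypothesis): the differents `D = e − 1` (`Cor312Prov.pred_div_le_differentOrd_of_eq`), the inner radii `ρin = e/2` over `3`
(abc-iut-c312-5's integer slot, `WRow.inner_witness_slot`) and `1` over `47`, the outer radii `ρout = min(3⁴ − 4eA, 3⁵ − 5eA)`, `min(3⁵ − 5eB, 3⁶ − 6eB)`,
`min(47 − eC, 47² − 2eC)` (`WRow.outer_member_min`, `11 ∣ e` puts `e` off the cyclotomic indices), and the socket's TYPE-PROFILE cells at every label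
`j ≤ 5` and every profile `f : Caps(j) → Fin 2`: with a slot of the SHALLOW type B present, `s :=` that slot makes the Θ-side `≤ j²/11` while
the q-side is `≥ 2(j+1)`; an all-A profile is the single-type cell of the `h = 24` place, an all-C profile that of `47` — both affine in `1/e`,
decreasing, checked at `e = 110·k`, `165·k`, `k ≥ 1` (`nlinarith` per label). [cite: Mochizuki2012, IUTchI Def. 3.1 (b),(c) pp. 61–62; IUTchIII Cor. 3.12 Step (xi-d) p. 183, (xi-f) p. 184, Thm. 3.11 (i) (Ind1)(Ind2) p. 154; IUTchIV Prop. 1.1 p. 9, Prop. 1.2 (i)(ii) p. 10, Prop. 1.4 (i)(ii) p. 13, Cor. 2.2 (ii) proof (P5) p. 46]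
[cite: DupuyHilado2025, §3.3, §3.4, §3.9, §4.9, §4.12] [claim: Mochizuki2012, status: disputed] -/
theorem WRow.licence_of_brobergTypes_eleven (hl : X.lstar = 5)
    (c : ∀ pp : Nat.Primes, (thetaIndex X).Fibre (.inr pp) → Fin 2) (eA eB eC : ℕ)
    (hdA : 110 ∣ eA) (hdB : 330 ∣ eB) (hdC : 165 ∣ eC)
    (hbad : ∀ (pp : Nat.Primes) (x : (thetaIndex X).Fibre (.inr pp)), haveI : Fact (pp : ℕ).Prime := ⟨pp.2⟩
      placeOf X pp.1 x ∈ X.S → (pp : ℕ) = 3 ∨ (pp : ℕ) = 47)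
    (h3 : ∀ (pp : Nat.Primes) (x : (thetaIndex X).Fibre (.inr pp)), haveI : Fact (pp : ℕ).Prime := ⟨pp.2⟩
      (pp : ℕ) = 3 → placeOf X pp.1 x ∈ X.S →
        (c pp x = 0 → absRamificationIdx (pp : ℕ) (kOf X pp.1 x) = eA ∧ X.qPilot (placeOf X pp.1 x) = ((12 * eA / 11 : ℕ) : ℝ)) ∧
        (c pp x = 1 → absRamificationIdx (pp : ℕ) (kOf X pp.1 x) = eB ∧ X.qPilot (placeOf X pp.1 x) = ((eB / 11 : ℕ) : ℝ)))
    (h47 : ∀ (pp : Nat.Primes) (x : (thetaIndex X).Fibre (.inr pp)), haveI : Fact (pp : ℕ).Prime := ⟨pp.2⟩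
      (pp : ℕ) = 47 → placeOf X pp.1 x ∈ X.S →
        c pp x = 0 ∧ absRamificationIdx (pp : ℕ) (kOf X pp.1 x) = eC ∧ X.qPilot (placeOf X pp.1 x) = ((4 * eC / 11 : ℕ) : ℝ))
    (hiso : ∀ (pp : Nat.Primes) (x y : (thetaIndex X).Fibre (.inr pp)),
      haveI : Fact (pp : ℕ).Prime := ⟨pp.2⟩
      placeOf X pp.1 x ∈ X.S → placeOf X pp.1 y ∈ X.S → c pp x = c pp y → Nonempty (kOf X pp.1 x ≃ₐ[ℚ_[pp]] kOf X pp.1 y)) :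
    Thm311ToCor312.Licence (settingPrVolSharp X hlog M archPk archSub Ψ act Mmod region n lat sig split qData tq t htq0 htq1) := by
  classical
  -- the per-type data fed to the socket
  let eT : Nat.Primes → Fin 2 → ℕ := fun pp u => if (pp : ℕ) = 3 then (if u = 0 then eA else eB) else eC
  let DT : Nat.Primes → Fin 2 → ℕ := fun pp u => eT pp u - 1
  let PT : Nat.Primes → Fin 2 → ℕ := fun pp u => if (pp : ℕ) = 3 then (if u = 0 then 12 * eA / 11 else eB / 11) else 4 * eC / 11
  let rinT : Nat.Primes → Fin 2 → ℤ := fun pp u => if (pp : ℕ) = 3 then ((eT pp u / 2 : ℕ) : ℤ) else 1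
  let routT : Nat.Primes → Fin 2 → ℤ := fun pp u =>
    if (pp : ℕ) = 3 then (if u = 0 then min ((3 : ℤ) ^ 4 - 4 * (eA : ℤ)) ((3 : ℤ) ^ 5 - 5 * (eA : ℤ))
      else min ((3 : ℤ) ^ 5 - 5 * (eB : ℤ)) ((3 : ℤ) ^ 6 - 6 * (eB : ℤ)))
    else min ((47 : ℤ) ^ 1 - 1 * (eC : ℤ)) ((47 : ℤ) ^ 2 - 2 * (eC : ℤ))
  have h01 : ∀ u : Fin 2, u = 0 ∨ u = 1 := by decide
  refine licence_settingPrVolSharp_of_mixedOrders_of_realises X hlog M archPk archSub Ψ act Mmod region n lat sig split qData tq t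
    htq0 htq1 ht0 ht htq (fun _ => 2) c eT DT PT rinT routT (fun pp x hx => ?_) hiso (fun pp i f hocc => ?_)
  · -- the local packages at a bad place
    haveI : Fact (pp : ℕ).Prime := ⟨pp.2⟩
    rcases hbad pp x hx with hp | hp
    · -- over `3`: type A (`u = 0`) or type B (`u = 1`)
      have hne7 : ∀ {e : ℕ}, 11 ∣ e → ∀ k : ℕ, (e : ℤ) ≠ (((pp : ℕ) : ℕ) : ℤ) ^ k * ((((pp : ℕ) : ℕ) : ℤ) - 1) := fun h7 =>
        WRow.natCast_ne_pow_mul_sub_one (by norm_num : Nat.Prime 11) pp.2 (by rw [hp]; norm_num) (by rw [hp]; norm_num) h7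
      rcases h01 (c pp x) with hu | hu
      · obtain ⟨hE, hP⟩ := (h3 pp x hp hx).1 hu
        have he : eT pp (c pp x) = eA := by simp [eT, hp, hu]
        refine ⟨by rw [he]; exact hE, ?_, ?_, ?_, ?_⟩
        · rw [show DT pp (c pp x) = eA - 1 by simp [DT, he], he]; exact Cor312Prov.pred_div_le_differentOrd_of_eq (pp : ℕ) hE
        · rw [hP]; simp [PT, hp, hu]
        · rw [he]; exact WRow.inner_witness_slot (pp : ℕ) (by rw [hp]; norm_num) hE (by simp [rinT, hp, he])
        · rw [he]
          exact WRow.outer_member_min (pp : ℕ) hE (hne7 (dvd_trans (by norm_num) hdA)) 4 5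
            (show (((pp : ℕ) : ℕ) : ℤ) = 3 by exact_mod_cast hp) (by simp [routT, hp, hu])
      · obtain ⟨hE, hP⟩ := (h3 pp x hp hx).2 hu
        have he : eT pp (c pp x) = eB := by simp [eT, hp, hu]
        refine ⟨by rw [he]; exact hE, ?_, ?_, ?_, ?_⟩
        · rw [show DT pp (c pp x) = eB - 1 by simp [DT, he], he]; exact Cor312Prov.pred_div_le_differentOrd_of_eq (pp : ℕ) hE
        · rw [hP]; simp [PT, hp, hu]
        · rw [he]; exact WRow.inner_witness_slot (pp : ℕ) (by rw [hp]; norm_num) hE (by simp [rinT, hp, he])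
        · rw [he]
          exact WRow.outer_member_min (pp : ℕ) hE (hne7 (dvd_trans (by norm_num) hdB)) 5 6
            (show (((pp : ℕ) : ℕ) : ℤ) = 3 by exact_mod_cast hp) (by simp [routT, hp, hu])
    · -- over `47`: one type
      obtain ⟨hu, hE, hP⟩ := h47 pp x hp hx
      have hp3 : (pp : ℕ) ≠ 3 := by rw [hp]; norm_num
      have he : eT pp (c pp x) = eC := by simp [eT, hp3]
      refine ⟨by rw [he]; exact hE, ?_, ?_, ?_, ?_⟩
      · rw [show DT pp (c pp x) = eC - 1 by simp [DT, he], he]; exact Cor312Prov.pred_div_le_differentOrd_of_eq (pp : ℕ) hE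
      · rw [hP]; simp [PT, hp3]
      · rw [he, show rinT pp (c pp x) = 1 by simp [rinT, hp3]]; exact WRow.inner_witness_trivial (pp : ℕ) _ eC
      · rw [he]
        exact WRow.outer_member_min (pp : ℕ) hE
          (WRow.natCast_ne_pow_mul_sub_one (by norm_num : Nat.Prime 11) pp.2 (by rw [hp]; norm_num) (by rw [hp]; norm_num)
            (dvd_trans (by norm_num) hdC)) 1 2
          (show (((pp : ℕ) : ℕ) : ℤ) = 47 by exact_mod_cast hp) (by simp [routT, hp3])
  · -- the cells, per label and type profile
    haveI : Fact (pp : ℕ).Prime := ⟨pp.2⟩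
    have hi : (i : ℕ) < 5 := hl ▸ i.isLt
    have hcard : Fintype.card ((thetaIndex X).Caps (Setting.labelSucc i)) = (i : ℕ) + 2 := by
      have hc : Fintype.card ((thetaIndex X).Caps (Setting.labelSucc i)) =
          Fintype.card (Fin (((Setting.labelSucc i : (thetaIndex X).Label) : ℕ) + 1)) := rfl
      rw [hc, Fintype.card_fin]
      simp [Setting.labelSucc]
    obtain ⟨x₀, hx₀, -⟩ := hocc (Fin.last _)
    rcases hbad pp x₀ hx₀ with hp | hp
    · -- over `3`
      by_cases hB : ∃ a, f a = 1
      · -- a slot of the SHALLOW type B is present: take `s` there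
        obtain ⟨s, hs⟩ := hB
        obtain ⟨xs, hxs, hcs⟩ := hocc s
        have hEB : absRamificationIdx (pp : ℕ) (kOf X pp.1 xs) = eB := ((h3 pp xs hp hxs).2 (hcs.trans hs)).1
        have hB0 : 0 < eB := hEB ▸ absRamificationIdx_pos (pp : ℕ) (kOf X pp.1 xs)
        refine ⟨s, WRow.forall_int_le_of_le ?_⟩
        -- A-side ≤ (i+1)²/7
        have hPe : ((((i : ℕ) + 1 : ℕ) : ℝ) ^ 2 * (PT pp (f s) : ℝ)) / (eT pp (f s) : ℝ) = ((((i : ℕ) + 1 : ℕ) : ℝ) ^ 2) / 11 := by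
          have h1 : (PT pp (f s) : ℝ) = ((eB / 11 : ℕ) : ℝ) := by simp [PT, hp, hs]
          have h2 : (eT pp (f s) : ℝ) = (eB : ℝ) := by simp [eT, hp, hs]
          rw [h1, h2]
          obtain ⟨k, hk⟩ := hdB
          rw [hk, show 330 * k / 11 = 30 * k by omega]
          have hk0 : (0 : ℝ) < k := by
            have : 0 < k := by omega
            exact_mod_cast this
          push_cast
          field_simp
          ring
        have hgain : 0 ≤ (∑ a, (DT pp (f a) : ℝ) / (eT pp (f a) : ℝ)) -
            ∑ u ∈ (Finset.univ.image f), (DT pp u : ℝ) / (eT pp u : ℝ) :=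
          sub_nonneg.mpr (WRow.sum_image_le_sum f (fun u => (DT pp u : ℝ) / (eT pp u : ℝ)) fun u => by positivity)
        have hrin : 0 ≤ ∑ a, (rinT pp (f a) : ℝ) / (eT pp (f a) : ℝ) :=
          Finset.sum_nonneg fun a _ => by
            have h0 : 0 ≤ rinT pp (f a) := by
              dsimp only [rinT]
              rw [if_pos hp]
              positivity
            have : (0 : ℝ) ≤ (rinT pp (f a) : ℝ) := by exact_mod_cast h0
            positivity
        -- B-side ≥ 2·(i+2)
        have hterm : ∀ a, (routT pp (f a) : ℝ) / (eT pp (f a) : ℝ) ≤ -2 := by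
          intro a
          obtain ⟨xa, hxa, hca⟩ := hocc a
          rcases h01 (f a) with hfa | hfa
          · have hEA : absRamificationIdx (pp : ℕ) (kOf X pp.1 xa) = eA := ((h3 pp xa hp hxa).1 (hca.trans hfa)).1
            have hA0 : 0 < eA := hEA ▸ absRamificationIdx_pos (pp : ℕ) (kOf X pp.1 xa)
            have hA70 : (110 : ℝ) ≤ eA := by
              obtain ⟨k, hk⟩ := hdA
              have h70 : 110 ≤ eA := by omega
              exact_mod_cast h70
            have h1 : (routT pp (f a) : ℝ) ≤ 81 - 4 * (eA : ℝ) := by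
              have : routT pp (f a) ≤ (3 : ℤ) ^ 4 - 4 * (eA : ℤ) := by simp only [routT, hp, hfa, if_true]; exact min_le_left _ _
              have := (Int.cast_le (R := ℝ)).mpr this; push_cast at this; linarith
            have h2 : (eT pp (f a) : ℝ) = eA := by simp [eT, hp, hfa]
            rw [h2, div_le_iff₀ (by exact_mod_cast hA0)]
            linarith
          · have hB210 : (330 : ℝ) ≤ eB := by
              obtain ⟨k, hk⟩ := hdB
              have h210 : 330 ≤ eB := by omega
              exact_mod_cast h210
            have h1 : (routT pp (f a) : ℝ) ≤ 243 - 5 * (eB : ℝ) := by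
              have : routT pp (f a) ≤ (3 : ℤ) ^ 5 - 5 * (eB : ℤ) := by simp only [routT, hp, hfa, if_true]; exact min_le_left _ _
              have := (Int.cast_le (R := ℝ)).mpr this; push_cast at this; linarith
            have h2 : (eT pp (f a) : ℝ) = eB := by simp [eT, hp, hfa]
            rw [h2, div_le_iff₀ (by exact_mod_cast hB0)]
            linarith
        have hsumout : ∑ a, (routT pp (f a) : ℝ) / (eT pp (f a) : ℝ) ≤ -(2 * (((i : ℕ) : ℝ) + 2)) := by
          calc ∑ a, (routT pp (f a) : ℝ) / (eT pp (f a) : ℝ) ≤ ∑ _a : (thetaIndex X).Caps (Setting.labelSucc i), (-2 : ℝ) :=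
                Finset.sum_le_sum fun a _ => hterm a
            _ = -(2 * (((i : ℕ) : ℝ) + 2)) := by
                rw [Finset.sum_const, Finset.card_univ, hcard, nsmul_eq_mul]; push_cast; ring
        have hPl : 0 ≤ (PT pp (f (Fin.last _)) : ℝ) / (eT pp (f (Fin.last _)) : ℝ) := by positivity
        have hi2 : ((((i : ℕ) + 1 : ℕ) : ℝ) ^ 2) ≤ 25 := by
          have : (((i : ℕ) + 1 : ℕ) : ℝ) ≤ 5 := by exact_mod_cast (by omega : (i : ℕ) + 1 ≤ 5)
          have h0 : (0 : ℝ) ≤ (((i : ℕ) + 1 : ℕ) : ℝ) := by positivity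
          nlinarith
        have hi0 : (0 : ℝ) ≤ ((i : ℕ) : ℝ) := by positivity
        rw [hPe]
        linarith
      · -- all slots of type A: the single-type cell of the `h = 24` place
        have hf0 : ∀ a, f a = 0 := fun a => (h01 (f a)).resolve_right fun h => hB ⟨a, h⟩
        have hf : f = fun _ => 0 := funext hf0
        subst hf
        obtain ⟨xa, hxa, hca⟩ := hocc (Fin.last _)
        have hEA : absRamificationIdx (pp : ℕ) (kOf X pp.1 xa) = eA := ((h3 pp xa hp hxa).1 hca).1
        have hA0 : 0 < eA := hEA ▸ absRamificationIdx_pos (pp : ℕ) (kOf X pp.1 xa)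
        obtain ⟨k, hk⟩ := hdA
        have hk1 : 1 ≤ k := by omega
        refine ⟨Fin.last _, WRow.forall_int_le_of_le ?_⟩
        have himg : (Finset.univ : Finset ((thetaIndex X).Caps (Setting.labelSucc i))).image (fun _ => (0 : Fin 2)) = {0} :=
          Finset.image_const Finset.univ_nonempty 0
        rw [himg, Finset.sum_singleton]
        simp only [Finset.sum_const, Finset.card_univ, hcard, nsmul_eq_mul]
        have he0 : (eT pp 0 : ℝ) = 110 * k := by simp [eT, hp, hk]
        have hD0 : (DT pp 0 : ℝ) = 110 * k - 1 := by
          have : DT pp 0 = 110 * k - 1 := by simp [DT, eT, hp, hk]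
          rw [this, Nat.cast_sub (by omega)]; push_cast; ring
        have hP0 : (PT pp 0 : ℝ) = 120 * k := by
          have : PT pp 0 = 120 * k := by simp [PT, hp, hk]; omega
          rw [this]; push_cast; ring
        have hrin0 : (rinT pp 0 : ℝ) = 55 * k := by
          have : rinT pp 0 = ((55 * k : ℕ) : ℤ) := by simp [rinT, eT, hp, hk]; omega
          rw [this]; push_cast; ring
        have hrout0 : (routT pp 0 : ℝ) ≤ 81 - 440 * k := by
          have : routT pp 0 ≤ (3 : ℤ) ^ 4 - 4 * (eA : ℤ) := by simp only [routT, hp, if_true]; exact min_le_left _ _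
          have := (Int.cast_le (R := ℝ)).mpr this; push_cast at this; rw [hk] at this; push_cast at this; linarith
        have hk1' : (1 : ℝ) ≤ k := by exact_mod_cast hk1
        have hkpos : (0 : ℝ) < 110 * k := by linarith
        rw [he0, hD0, hP0, hrin0]
        have hnum : ∀ ii : ℕ, ii < 5 →
            (((ii + 1 : ℕ) : ℝ) ^ 2 * (120 * k) - (((ii + 2 : ℕ) : ℝ) * (110 * k - 1) - (110 * k - 1)) -
                ((ii + 2 : ℕ) : ℝ) * (55 * k)) ≤ 120 * k - ((ii + 2 : ℕ) : ℝ) * (routT pp 0 : ℝ) := by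
          intro ii hii
          interval_cases ii <;> push_cast <;> nlinarith [hrout0, hk1']
        have key := div_le_div_of_nonneg_right (hnum i hi) hkpos.le
        convert key using 1 <;> first | rfl | ring
    · -- over `47`: one type, the single-type tame cell
      have hp3 : (pp : ℕ) ≠ 3 := by rw [hp]; norm_num
      have hf0 : ∀ a, f a = 0 := fun a => by obtain ⟨xa, hxa, hca⟩ := hocc a; exact hca ▸ (h47 pp xa hp hxa).1
      have hf : f = fun _ => 0 := funext hf0
      subst hf
      obtain ⟨-, hEC, -⟩ := h47 pp x₀ hp hx₀
      have hC0 : 0 < eC := hEC ▸ absRamificationIdx_pos (pp : ℕ) (kOf X pp.1 x₀)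
      obtain ⟨k, hk⟩ := hdC
      have hk1 : 1 ≤ k := by omega
      refine ⟨Fin.last _, WRow.forall_int_le_of_le ?_⟩
      have himg : (Finset.univ : Finset ((thetaIndex X).Caps (Setting.labelSucc i))).image (fun _ => (0 : Fin 2)) = {0} :=
        Finset.image_const Finset.univ_nonempty 0
      rw [himg, Finset.sum_singleton]
      simp only [Finset.sum_const, Finset.card_univ, hcard, nsmul_eq_mul]
      have he0 : (eT pp 0 : ℝ) = 165 * k := by simp [eT, hp3, hk]
      have hD0 : (DT pp 0 : ℝ) = 165 * k - 1 := by
        have : DT pp 0 = 165 * k - 1 := by simp [DT, eT, hp3, hk]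
        rw [this, Nat.cast_sub (by omega)]; push_cast; ring
      have hP0 : (PT pp 0 : ℝ) = 60 * k := by
        have : PT pp 0 = 60 * k := by simp [PT, hp3, hk]; omega
        rw [this]; push_cast; ring
      have hrin0 : (rinT pp 0 : ℝ) = 1 := by simp [rinT, hp3]
      have hrout0 : (routT pp 0 : ℝ) ≤ 47 - 165 * k := by
        have : routT pp 0 ≤ (47 : ℤ) ^ 1 - 1 * (eC : ℤ) := by simp only [routT, hp3, if_false]; exact min_le_left _ _
        have := (Int.cast_le (R := ℝ)).mpr this; push_cast at this; rw [hk] at this; push_cast at this; linarith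
      have hk1' : (1 : ℝ) ≤ k := by exact_mod_cast hk1
      have hkpos : (0 : ℝ) < 165 * k := by linarith
      rw [he0, hD0, hP0, hrin0]
      have hnum : ∀ ii : ℕ, ii < 5 →
          (((ii + 1 : ℕ) : ℝ) ^ 2 * (60 * k) - (((ii + 2 : ℕ) : ℝ) * (165 * k - 1) - (165 * k - 1)) -
              ((ii + 2 : ℕ) : ℝ) * 1) ≤ 60 * k - ((ii + 2 : ℕ) : ℝ) * (routT pp 0 : ℝ) := by
        intro ii hii
        interval_cases ii <;> push_cast <;> nlinarith [hrout0, hk1']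
      have key := div_le_div_of_nonneg_right (hnum i hi) hkpos.le
      convert key using 1 <;> first | rfl | ring


include ht0 ht htq in
/-- **BRANCH C's PER-DATUM ANTECEDENT «∃ ρ qK, QPinned ∧ PilotKummerCompatHull» at broberg-shaped data, `l = 11`** (any columns `col`; the
realising q-ideles have norm `≤ 1`, abc-iut-w5-d009's `exists_qPinned_and_hull_settingPrVolSharp_iff_licence`): the per-datum S_H object of the
window certificates' binder `hSHwBad` (p453137 / p450130) is INHABITED under the hypotheses of `WRow.licence_of_brobergTypes_eleven`.
[cite: Mochizuki2012, IUTchIII Cor. 3.12 Step (xi-d) p. 183, (xi-f) p. 184] [cite: DupuyHilado2025, §3.3, §3.4, §4.9] [claim: Mochizuki2012, status: disputed] -/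
theorem WRow.exists_qPinned_and_hull_of_brobergTypes_eleven (hl : X.lstar = 5)
    (c : ∀ pp : Nat.Primes, (thetaIndex X).Fibre (.inr pp) → Fin 2) (eA eB eC : ℕ)
    (hdA : 110 ∣ eA) (hdB : 330 ∣ eB) (hdC : 165 ∣ eC)
    (hbad : ∀ (pp : Nat.Primes) (x : (thetaIndex X).Fibre (.inr pp)), haveI : Fact (pp : ℕ).Prime := ⟨pp.2⟩
      placeOf X pp.1 x ∈ X.S → (pp : ℕ) = 3 ∨ (pp : ℕ) = 47)
    (h3 : ∀ (pp : Nat.Primes) (x : (thetaIndex X).Fibre (.inr pp)), haveI : Fact (pp : ℕ).Prime := ⟨pp.2⟩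
      (pp : ℕ) = 3 → placeOf X pp.1 x ∈ X.S →
        (c pp x = 0 → absRamificationIdx (pp : ℕ) (kOf X pp.1 x) = eA ∧ X.qPilot (placeOf X pp.1 x) = ((12 * eA / 11 : ℕ) : ℝ)) ∧
        (c pp x = 1 → absRamificationIdx (pp : ℕ) (kOf X pp.1 x) = eB ∧ X.qPilot (placeOf X pp.1 x) = ((eB / 11 : ℕ) : ℝ)))
    (h47 : ∀ (pp : Nat.Primes) (x : (thetaIndex X).Fibre (.inr pp)), haveI : Fact (pp : ℕ).Prime := ⟨pp.2⟩
      (pp : ℕ) = 47 → placeOf X pp.1 x ∈ X.S →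
        c pp x = 0 ∧ absRamificationIdx (pp : ℕ) (kOf X pp.1 x) = eC ∧ X.qPilot (placeOf X pp.1 x) = ((4 * eC / 11 : ℕ) : ℝ))
    (hiso : ∀ (pp : Nat.Primes) (x y : (thetaIndex X).Fibre (.inr pp)),
      haveI : Fact (pp : ℕ).Prime := ⟨pp.2⟩
      placeOf X pp.1 x ∈ X.S → placeOf X pp.1 y ∈ X.S → c pp x = c pp y → Nonempty (kOf X pp.1 x ≃ₐ[ℚ_[pp]] kOf X pp.1 y)) :
    ∃ (ρ' : (∀ v : (thetaIndex X).V, v ∈ (thetaIndex X).Vbad → Set ((logShellsDH X logv).StarPacket v)) →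
          ∀ (j : (thetaIndex X).Label) (vQ : (thetaIndex X).VQ), Set ((logShellsDH X logv).Packet j vQ))
      (qK : ∀ v : (thetaIndex X).V, v ∈ (thetaIndex X).Vbad → Set ((logShellsDH X logv).StarPacket v)),
      QPinned ({ toSituation := situationPrVol X hlog M archPk archSub Ψ act Mmod region, col := col } : LatticeSituation (thetaIndex X))
        (settingPrVolSharp X hlog M archPk archSub Ψ act Mmod region n lat sig split qData tq t htq0 htq1) ρ' qK ∧
      PilotKummerCompatHull ({ toSituation := situationPrVol X hlog M archPk archSub Ψ act Mmod region, col := col } :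
          LatticeSituation (thetaIndex X))
        (settingPrVolSharp X hlog M archPk archSub Ψ act Mmod region n lat sig split qData tq t htq0 htq1) ρ' qK :=
  (exists_qPinned_and_hull_settingPrVolSharp_iff_licence X hlog M archPk archSub Ψ act Mmod region n lat sig split qData tq t htq0 htq1 col
    (fun pp x => norm_qIdele_le_one_of_realises X tq htq0 htq pp x)).2
    (WRow.licence_of_brobergTypes_eleven X hlog M archPk archSub Ψ act Mmod region n lat sig split qData tq t htq0 htq1 ht0 ht htq hl c eA eB eC
      hdA hdB hdC hbad h3 h47 hiso)

end Summit.ABC.IUTFork.Conditional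

end
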